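import Summits.ResolutionOfSingularities.ResolutionOfSingularities.Theorems.FrobeniusClosingSteerToricConcl

/-!
# Crux `Steer` (stmt-ResolutionOfSingularities-16345) — the toric LU brick ON SPECIMEN F (kernel instance of (T1)/(T3))

OURS (campaign res-hironaka, rung L ★L-G4, slot W4.1; res-type-028 g10, OFFER (i) of 2026-08-27T12:28:49Z, booked by res-L0-w41-plan-1
RULING 121b «afterwards as the tool's first instance»). Theses-free; `--supports stmt-ResolutionOfSingularities-16345`, counted 0. NOT a
statement of the manuscript under review [claim: Hironaka2017, status: under-review]; AI seat, weaker than expert review.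

SPECIMEN F (res-L0-w41-tri-3 row R-O; res-type-054 U10): `t² = f = u₁u₂²u₃⁴ + u₀³u₁⁶u₂u₃` over a field `k` of characteristic 2,
`K = k(u₀, …, u₃, t)`, `A₀ = k[u]`; along every valuation ring of the eternal period-5 ray the σ_top-steered run never exits, yet
`Concl O A₀ t` holds by a TORIC CHART (label of record 111e: «Concl TRUE on F by the tree theorem `concl_of_toricChart`», so far BY HAND —
tri-3 `toric-F.md` 68b7ba053cdb55c6). THIS FILE is the kernel certificate, uniformly in `O`: for EVERY valuation ring `O ⊇ k` of `K`
containing the four chart monomials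

  `z₀ = t·u₀²u₁³/(u₂²u₃⁴)`, `z₁ = u₂u₃²/u₁⁴`, `z₂ = u₀u₁⁴/(u₂u₃²)`, `z₃ = u₂²u₃⁴/(u₀⁴u₁⁷)`

(the dual basis of the unimodular cone `σ = cone((1,0,0,0), (10,1,2,9), (18,1,4,16), (5,0,1,4))` in the weight space of the torus
letters `y = (t, u₀, u₁, u₂u₃²)`; on F's ray `ω = (γ/2)·(1,0,0,0) + a·(10,1,2,9) + c·(18,1,4,16)` with `a, c > 0`, so `v(z₁), v(z₂) > 0`,
`v(z₃) = 0` EXACTLY and `v(z₀) = γ/2 ≥ 0`, `γ = v(1 + u^{M₂−M₁})` the free parameter — res-type-028 `work/specF/basis.py`) and in which the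
balanced monomial `u^{M₂−M₁} = u₀³u₁⁵/(u₂u₃³)` is a UNIT (value `1`; automatic on the ray: `w·M₁ = w·M₂`), one has `Concl O k[u] t`.
Chart identities (characteristic 2 is used once, for `1 + q = u^{M₂−M₁}` with `q = t²/u^{M₁} = z₀²z₃`): `u₀ = z₁z₂`, `u₁ = z₁²z₂⁴z₃`,
`u₂ = z₁z₂²z₃²·(1+q)²`, `u₃ = z₁⁴z₂⁷z₃·(1+q)⁻¹`, `t = z₀z₁¹⁰z₂¹⁸z₃⁵`; so `k(z) = K`, `z` is a transcendence basis (trdeg 4), `k[u] ∪ {t}`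
lies in the local ring of `k[z]` at the centre, and (T1) `SteerToricConcl.concl_of_polynomialChart` applies. [folklore]
-/

noncomputable section

-- single-problem summit: the doubled namespace component `ResolutionOfSingularities` is forced
set_option linter.dupNamespace false

open scoped BigOperators

namespace Summit.ResolutionOfSingularities.ResolutionOfSingularities.Theorems.SteerToricSpecimenF

open Summit.ResolutionOfSingularities.ResolutionOfSingularities.Theorems.SwitchingDichotomy.Words (Concl)
open Literature.AlgebraicGeometry.Resolution

variable {k K : Type} [Field k] [Field K] [Algebra k K]

section Identities

variable (u : Fin 4 → K) (t : K) (hu0 : ∀ i, u i ≠ 0)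
include hu0

/-- `u₀ = z₁ z₂`. [folklore] -/
theorem u0_eq : u 0 = (u 2 * u 3 ^ 2 / u 1 ^ 4) * (u 0 * u 1 ^ 4 / (u 2 * u 3 ^ 2)) := by
  have := hu0 0; have := hu0 1; have := hu0 2; have := hu0 3
  field_simp

/-- `u₁ = z₁² z₂⁴ z₃`. [folklore] -/
theorem u1_eq : u 1 = (u 2 * u 3 ^ 2 / u 1 ^ 4) ^ 2 * (u 0 * u 1 ^ 4 / (u 2 * u 3 ^ 2)) ^ 4 * (u 2 ^ 2 * u 3 ^ 4 / (u 0 ^ 4 * u 1 ^ 7)) := by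
  have := hu0 0; have := hu0 1; have := hu0 2; have := hu0 3
  field_simp

/-- `t = z₀ z₁¹⁰ z₂¹⁸ z₃⁵`. [folklore] -/
theorem t_eq : t = (t * u 0 ^ 2 * u 1 ^ 3 / (u 2 ^ 2 * u 3 ^ 4)) * (u 2 * u 3 ^ 2 / u 1 ^ 4) ^ 10 * (u 0 * u 1 ^ 4 / (u 2 * u 3 ^ 2)) ^ 18 * (u 2 ^ 2 * u 3 ^ 4 / (u 0 ^ 4 * u 1 ^ 7)) ^ 5 := by
  have := hu0 0; have := hu0 1; have := hu0 2; have := hu0 3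
  field_simp

/-- `u₀⁻⁶u₁⁻¹⁰u₂³u₃⁶ = z₁ z₂² z₃²` (the monomial part of `u₂`). [folklore] -/
theorem monoA_eq : u 2 ^ 3 * u 3 ^ 6 / (u 0 ^ 6 * u 1 ^ 10) = (u 2 * u 3 ^ 2 / u 1 ^ 4) * (u 0 * u 1 ^ 4 / (u 2 * u 3 ^ 2)) ^ 2 * (u 2 ^ 2 * u 3 ^ 4 / (u 0 ^ 4 * u 1 ^ 7)) ^ 2 := by
  have := hu0 0; have := hu0 1; have := hu0 2; have := hu0 3
  field_simp

/-- `u₀³u₁⁵u₂⁻¹u₃⁻² = z₁⁴ z₂⁷ z₃` (the monomial part of `u₃`). [folklore] -/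
theorem monoB_eq : u 0 ^ 3 * u 1 ^ 5 / (u 2 * u 3 ^ 2) = (u 2 * u 3 ^ 2 / u 1 ^ 4) ^ 4 * (u 0 * u 1 ^ 4 / (u 2 * u 3 ^ 2)) ^ 7 * (u 2 ^ 2 * u 3 ^ 4 / (u 0 ^ 4 * u 1 ^ 7)) := by
  have := hu0 0; have := hu0 1; have := hu0 2; have := hu0 3
  field_simp

/-- `q = t²/u^{M₁} = z₀² z₃`. [folklore] -/
theorem q_eq : t ^ 2 / (u 1 * u 2 ^ 2 * u 3 ^ 4) = (t * u 0 ^ 2 * u 1 ^ 3 / (u 2 ^ 2 * u 3 ^ 4)) ^ 2 * (u 2 ^ 2 * u 3 ^ 4 / (u 0 ^ 4 * u 1 ^ 7)) := by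
  have := hu0 0; have := hu0 1; have := hu0 2; have := hu0 3
  field_simp

/-- In characteristic `2`, `1 + q = u^{M₂ − M₁} = u₀³u₁⁵/(u₂u₃³)` on specimen F (`t² = u^{M₁} + u^{M₂}`). [folklore] -/
theorem one_add_q_eq [CharP K 2] (ht : t ^ 2 = u 1 * u 2 ^ 2 * u 3 ^ 4 + u 0 ^ 3 * u 1 ^ 6 * u 2 * u 3) :
    1 + t ^ 2 / (u 1 * u 2 ^ 2 * u 3 ^ 4) = u 0 ^ 3 * u 1 ^ 5 / (u 2 * u 3 ^ 3) := by
  have := hu0 0; have := hu0 1; have := hu0 2; have := hu0 3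
  have h2 : (2 : K) = 0 := CharTwo.two_eq_zero
  field_simp
  linear_combination ht + (u 1 * u 2 ^ 2 * u 3 ^ 4) * h2

end Identities

/-! ## The kernel certificate -/

/-- **SPECIMEN F: `Concl O k[u] t` BY THE TORIC CHART, uniformly in `O`.** `k ⊆ K` of characteristic `2`, `u : Fin 4 → K` algebraically
independent over `k`, `t² = u₁u₂²u₃⁴ + u₀³u₁⁶u₂u₃`, `K = k(u, t)`. For every valuation ring `O ⊇ k` of `K` containing the four chart
monomials `hz0`–`hz3` (⟺ its weight lies in the cone `σ`; on F's eternal ray: always) and in which `u^{M₂−M₁} = u₀³u₁⁵/(u₂u₃³)` is a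
unit (value `1`; on the ray: always, `w·M₁ = w·M₂`), the frontier conclusion holds: `Concl O k[u] t` — a finitely generated regular-at-the-
centre model `k[u] ⊆ A ⊆ O ∋ t` with `Frac A = K`, namely `k[z, u, t]` by (T1) `SteerToricConcl.concl_of_polynomialChart`. OURS. [folklore] -/
theorem specimenF_concl [CharP K 2] (u : Fin 4 → K) (hu : AlgebraicIndependent k u) (t : K)
    (ht : t ^ 2 = u 1 * u 2 ^ 2 * u 3 ^ 4 + u 0 ^ 3 * u 1 ^ 6 * u 2 * u 3)
    (hK : IntermediateField.adjoin k (insert t (Set.range u)) = ⊤)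
    (O : ValuationSubring K) (hk : ∀ c : k, algebraMap k K c ∈ O)
    (hz0 : t * u 0 ^ 2 * u 1 ^ 3 / (u 2 ^ 2 * u 3 ^ 4) ∈ O) (hz1 : u 2 * u 3 ^ 2 / u 1 ^ 4 ∈ O)
    (hz2 : u 0 * u 1 ^ 4 / (u 2 * u 3 ^ 2) ∈ O) (hz3 : u 2 ^ 2 * u 3 ^ 4 / (u 0 ^ 4 * u 1 ^ 7) ∈ O)
    (hunit : O.valuation (u 0 ^ 3 * u 1 ^ 5 / (u 2 * u 3 ^ 3)) = 1) :
    Concl O (Algebra.adjoin k (Set.range u)) t := by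
  classical
  have hu0 : ∀ i, u i ≠ 0 := fun i => hu.ne_zero i
  set z : Fin 4 → K := ![t * u 0 ^ 2 * u 1 ^ 3 / (u 2 ^ 2 * u 3 ^ 4), u 2 * u 3 ^ 2 / u 1 ^ 4,
    u 0 * u 1 ^ 4 / (u 2 * u 3 ^ 2), u 2 ^ 2 * u 3 ^ 4 / (u 0 ^ 4 * u 1 ^ 7)] with hzdef
  have hzO : ∀ j, z j ∈ O := by
    intro j; fin_cases j
    · exact hz0
    · exact hz1
    · exact hz2
    · exact hz3
  have ez0 : z 0 = (t * u 0 ^ 2 * u 1 ^ 3 / (u 2 ^ 2 * u 3 ^ 4)) := rfl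
  have ez1 : z 1 = (u 2 * u 3 ^ 2 / u 1 ^ 4) := rfl
  have ez2 : z 2 = (u 0 * u 1 ^ 4 / (u 2 * u 3 ^ 2)) := rfl
  have ez3 : z 3 = (u 2 ^ 2 * u 3 ^ 4 / (u 0 ^ 4 * u 1 ^ 7)) := rfl
  set B : Subalgebra k K := Algebra.adjoin k (Set.range z) with hBdef
  have hzB : ∀ j, z j ∈ B := fun j => Algebra.subset_adjoin (Set.mem_range_self j)
  -- the balanced unit `w = u^{M₂ − M₁} = 1 + q`, with `q = z₀² z₃ ∈ k[z]`
  set w : K := u 0 ^ 3 * u 1 ^ 5 / (u 2 * u 3 ^ 3) with hwdef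
  have hw0 : w ≠ 0 := ne_zero_of_valuation_eq_one hunit
  have hwq : w = 1 + z 0 ^ 2 * z 3 := by
    rw [hwdef, ← one_add_q_eq u t hu0 ht, q_eq u t hu0, ez0, ez3]
  have hwB : w ∈ B := by
    rw [hwq]; exact B.add_mem B.one_mem (B.mul_mem (B.pow_mem (hzB 0) 2) (hzB 3))
  -- the letters in terms of the chart
  have hu0B : u 0 ∈ B := by rw [u0_eq u hu0, ← ez1, ← ez2]; exact B.mul_mem (hzB 1) (hzB 2)
  have hu1B : u 1 ∈ B := by
    rw [u1_eq u hu0, ← ez1, ← ez2, ← ez3]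
    exact B.mul_mem (B.mul_mem (B.pow_mem (hzB 1) 2) (B.pow_mem (hzB 2) 4)) (hzB 3)
  have htB : t ∈ B := by
    rw [t_eq u t hu0, ← ez0, ← ez1, ← ez2, ← ez3]
    exact B.mul_mem (B.mul_mem (B.mul_mem (hzB 0) (B.pow_mem (hzB 1) 10)) (B.pow_mem (hzB 2) 18)) (B.pow_mem (hzB 3) 5)
  have hu2 : u 2 = (u 2 ^ 3 * u 3 ^ 6 / (u 0 ^ 6 * u 1 ^ 10)) * w ^ 2 := by
    have := hu0 0; have := hu0 1; have := hu0 2; have := hu0 3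
    rw [hwdef]; field_simp
  have hu3 : u 3 = (u 0 ^ 3 * u 1 ^ 5 / (u 2 * u 3 ^ 2)) * w⁻¹ := by
    have := hu0 0; have := hu0 1; have := hu0 2; have := hu0 3
    rw [hwdef]; field_simp
  have hu2B : u 2 ∈ B := by
    rw [hu2, monoA_eq u hu0, ← ez1, ← ez2, ← ez3]
    exact B.mul_mem (B.mul_mem (B.mul_mem (hzB 1) (B.pow_mem (hzB 2) 2)) (B.pow_mem (hzB 3) 2)) (B.pow_mem hwB 2)
  have hmonoB : u 0 ^ 3 * u 1 ^ 5 / (u 2 * u 3 ^ 2) ∈ B := by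
    rw [monoB_eq u hu0, ← ez1, ← ez2, ← ez3]
    exact B.mul_mem (B.mul_mem (B.pow_mem (hzB 1) 4) (B.pow_mem (hzB 2) 7)) (hzB 3)
  have hu3L : u 3 ∈ locAtCentre B.toSubring O := by
    rw [hu3]
    exact Subring.mul_mem _ (le_locAtCentre _ O hmonoB) (inv_mem_locAtCentre (le_locAtCentre _ O hwB) hunit)
  -- `k(z) = K`
  have hzK : IntermediateField.adjoin k (Set.range z) = ⊤ := by
    refine eq_top_iff.mpr ?_
    rw [← hK]
    refine IntermediateField.adjoin_le_iff.mpr ?_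
    have hBF : ∀ x, x ∈ B → x ∈ IntermediateField.adjoin k (Set.range z) := fun x hx =>
      IntermediateField.algebra_adjoin_le_adjoin k _ hx
    rintro x (rfl | ⟨i, rfl⟩)
    · exact hBF _ htB
    · fin_cases i
      · exact hBF _ hu0B
      · exact hBF _ hu1B
      · exact hBF _ hu2B
      · show u 3 ∈ _
        rw [hu3]
        exact mul_mem (hBF _ hmonoB) (inv_mem (hBF _ hwB))
  -- `trdeg_k K = 4`: `u` is a transcendence basis (`t` is algebraic over `k[u]`, and `K = k(u, t)`)
  have htop : ∀ x : K, x ∈ IntermediateField.adjoin k (insert t (Set.range u)) := fun x => by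
    rw [hK]; exact IntermediateField.mem_top
  have halg : Algebra.IsAlgebraic (Algebra.adjoin k (Set.range u)) K := by
    let T : Subfield K :=
      { (Subalgebra.algebraicClosure (Algebra.adjoin k (Set.range u)) K).toSubring with
        inv_mem' := fun x hx => IsAlgebraic.inv hx }
    have hT : ∀ x : K, x ∈ T ↔ IsAlgebraic (Algebra.adjoin k (Set.range u)) x := fun x => Iff.rfl
    have hfu : u 1 * u 2 ^ 2 * u 3 ^ 4 + u 0 ^ 3 * u 1 ^ 6 * u 2 * u 3 ∈ Algebra.adjoin k (Set.range u) := by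
      have h : ∀ i, u i ∈ Algebra.adjoin k (Set.range u) := fun i => Algebra.subset_adjoin (Set.mem_range_self i)
      exact Subalgebra.add_mem _ (Subalgebra.mul_mem _ (Subalgebra.mul_mem _ (h 1) (Subalgebra.pow_mem _ (h 2) 2))
        (Subalgebra.pow_mem _ (h 3) 4)) (Subalgebra.mul_mem _ (Subalgebra.mul_mem _ (Subalgebra.mul_mem _
        (Subalgebra.pow_mem _ (h 0) 3) (Subalgebra.pow_mem _ (h 1) 6)) (h 2)) (h 3))
    have hgen : (IntermediateField.adjoin k (insert t (Set.range u))).toSubfield ≤ T := by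
      rw [IntermediateField.adjoin_toSubfield]
      refine Subfield.closure_le.mpr ?_
      rintro x (⟨c, rfl⟩ | rfl | ⟨i, rfl⟩)
      · rw [SetLike.mem_coe, hT, IsScalarTower.algebraMap_apply k (Algebra.adjoin k (Set.range u)) K c]
        exact isAlgebraic_algebraMap _
      · rw [SetLike.mem_coe, hT]
        refine ⟨Polynomial.X ^ 2 - Polynomial.C ⟨_, hfu⟩, Polynomial.X_pow_sub_C_ne_zero two_pos _, ?_⟩
        rw [map_sub, map_pow, Polynomial.aeval_X, Polynomial.aeval_C, ht]
        exact sub_self _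
      · rw [SetLike.mem_coe, hT]
        exact isAlgebraic_algebraMap (⟨u i, Algebra.subset_adjoin ⟨i, rfl⟩⟩ : Algebra.adjoin k (Set.range u))
    exact ⟨fun x => (hT x).mp (hgen ((IntermediateField.mem_toSubfield _ _).mpr (htop x)))⟩
  have hbasis : IsTranscendenceBasis k u := (AlgebraicIndependent.isTranscendenceBasis_iff_isAlgebraic hu).mpr halg
  have htr : Cardinal.mk (Fin 4) = Algebra.trdeg k K := hbasis.cardinalMk_eq_trdeg
  -- `z` is algebraically independent
  haveI : FaithfulSMul k K := (faithfulSMul_iff_algebraMap_injective k K).mpr (algebraMap k K).injective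
  haveI : Algebra.IsAlgebraic (Algebra.adjoin k (Set.range z)) K := by
    haveI := SteerToricConcl.isFractionRing_adjoin_of_adjoin_eq_top z hzK
    exact IsLocalization.isAlgebraic K (nonZeroDivisors (Algebra.adjoin k (Set.range z)))
  have hzind : AlgebraicIndependent k z := (Algebra.IsAlgebraic.isTranscendenceBasis_of_le_trdeg_of_finite k z htr.le).1
  -- `k[u]` and `t` lie in the local ring of `k[z]` at the centre
  have hA₀fg : (Algebra.adjoin k (Set.range u)).FG := by
    refine ⟨Finset.univ.image u, ?_⟩
    rw [Finset.coe_image, Finset.coe_univ, Set.image_univ]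
  have hA₀L : (Algebra.adjoin k (Set.range u)).toSubring ≤ locAtCentre B.toSubring O := by
    refine SteerToricConcl.adjoin_toSubring_le_locAtCentre O B ?_
    rintro _ ⟨i, rfl⟩
    fin_cases i
    · exact le_locAtCentre _ O hu0B
    · exact le_locAtCentre _ O hu1B
    · exact le_locAtCentre _ O hu2B
    · exact hu3L
  exact SteerToricConcl.concl_of_polynomialChart O hk z hzind hzO hzK (Algebra.adjoin k (Set.range u)) hA₀fg hA₀L t
    (le_locAtCentre _ O htB)

end Summit.ResolutionOfSingularities.ResolutionOfSingularities.Theorems.SteerToricSpecimenF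

end
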